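import Mathlib
import Summits.QuantumFields.YangMills.Theorems.IsotropyFromPowerCountingCurvatureSandwichBoundGeneralWindow
import Literature.MathematicalPhysics.QuantumLattice.SchwartzHalfSpaceCutoffC
import Literature.Analysis.Distribution.SchwartzMultipliers
import HarnessLib

/-!
# Stub `stub_narrowReduction` for the crux `CurvatureSandwichBound` (line `Sketch`): narrow reduction

Support file for crux stmt-QuantumFields-18372 (`IsotropyFromPowerCounting.CurvatureSandwichBound`), registered
skeleton `Cruxes/CurvatureSandwichBound/Lines/Sketch.lean` (v4), stub (NR).  Fix a one-species family `T` on `ℝ⁴` with an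
`e₀`-reconstruction `h : OSReconstructionNoE1 T.toLabelled`, `s = 2u + v`, and the sandwich `X_f W := f ⊗ T_s W` of a
windowed product-form insertion `f = g ⊗ hh` (`f x = g (x⁰, x¹) hh (x², x³)`, `g p ≠ 0 → u ≤ p.1 ≤ 2u`).  **The stub**: if
`‖Ψ_{X_f W}‖ ≤ L·Mg·(Mh+Mh')·‖Ψ_W‖` holds for all such insertions whose `g` is NARROW AND CENTRED in `x¹` (`|p.2| ≤ w` on
`supp g`), it holds for all windowed insertions with constant `2L` (in fact `L`).

* Bookkeeping (`NarrowReduction.*`): time-ordering of weighted insertions, passage of norm bounds to `𝓢`-limits of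
  insertions (`norm_fieldVec_appendTensor_le_of_tendsto`: `tendsto_fieldVec`, `continuous_appendTensor`), product form
  and `L¹` mass of a weighted insertion `ψ(x¹) f` (`weighted_insertion`); additivity `Ψ_{Σ Gᵢ} = Σ Ψ_{Gᵢ}` is the tree's
  `GeneralWindow.fieldVec_sum`.
* `NarrowReduction.recenter`: centring by the unitary `x¹`-translation `U(c e₁)` (`translate_fieldVec`,
  `T_a (f ⊗ T_s W) = T_a f ⊗ T_s (T_a W)`, invariance of Lebesgue measure on `ℝ × ℝ`): the bound holds for `g` narrow
  around ANY centre `c`.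
* `NarrowReduction.partition`: bounded `x¹`-support `[a, b]` via the telescoping smooth partition of unity
  `ρ_i(t) = σ(w⁻¹(t−a)+1−i) − σ(w⁻¹(t−a)−i)` (`σ = Real.smoothTransition`, `0 ≤ ρ_i ≤ 1`, `Σ_{i<N} ρ_i = 1` on `[a, b]`,
  `supp ρ_i ⊆ [a+(i−1)w, a+(i+1)w]`): `f = Σ_i ρ_i(x¹) f`, each piece narrow around `a + i w`, `Σ_i ∫‖ρ_i g‖ = ∫‖g‖`.
* `NarrowReduction.of_bddBelow`, `NarrowReduction.of_window`, `stub_narrowReduction`: the support restriction is removed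
  by the half-space cutoffs of the tree, `cutLE 1 θ F → F` (`θ → +∞`, `tendsto_cutLE_atTop`) and `cutGE 1 θ F → F`
  (`θ → −∞`, `tendsto_cutGE_atBot`), each cutoff being a weighted insertion with `∫‖σ g‖ ≤ ∫‖g‖`.

References: K. Osterwalder, R. Schrader, Comm. Math. Phys. 31 (1973) §4.1 (4.5); J. Glimm, A. Jaffe, *Quantum Physics*
(2nd ed. 1987), §6.1, §10.5; L. Hörmander, ALPDO I, §1.4 and Lemma 7.1.8.
-/

noncomputable section

namespace Summit.QuantumFields.YangMills.Theorems.CurvatureSandwichBound.Sketch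

open scoped BigOperators SchwartzMap InnerProductSpace
open MeasureTheory Filter Topology
open Literature.MathematicalPhysics.QuantumLattice Literature.MathematicalPhysics.AQFT
  Literature.MathematicalPhysics.QuantumFieldTheory Literature.Probability.LatticeModels
open Summit.QuantumFields.YangMills.Theorems.NPointIsotropy.Negative (E4)
open Summit.QuantumFields.YangMills.Cruxes.PlanarSpectralCone.PositivityDiscToOperatorCone.Density
open GeneralWindow (fieldVec_sum)

namespace NarrowReduction

/-! ### Bookkeeping -/

/-- Multiplying the insertion by a temperate weight keeps `f ⊗ G` time-ordered (its support only shrinks). -/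
theorem isTimeOrdered_smulLeftCLM_appendTensor {n : ℕ} {c : (Fin 1 → E4) → ℂ} (hc : c.HasTemperateGrowth)
    (f₁ : 𝓢((Fin 1 → E4), ℂ)) (G : 𝓢((Fin n → E4), ℂ)) (hFW : IsTimeOrdered (f₁.appendTensor G)) :
    IsTimeOrdered ((SchwartzMap.smulLeftCLM ℂ c f₁).appendTensor G) := by
  refine fun y hy => hFW (closure_mono (fun x hx => ?_) hy)
  rw [Function.mem_support, SchwartzMap.appendTensor_apply, SchwartzMap.smulLeftCLM_apply_apply hc, smul_eq_mul] at hx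
  rw [Function.mem_support, SchwartzMap.appendTensor_apply]
  exact mul_ne_zero (right_ne_zero_of_mul (left_ne_zero_of_mul hx)) (right_ne_zero_of_mul hx)

/-- Translating a sandwich: `T_a (f ⊗ T_b W) = T_a f ⊗ T_b (T_a W)`. -/
theorem translateMulti_appendTensor_translateMulti {n : ℕ} (a b : E4) (f : 𝓢((Fin 1 → E4), ℂ)) (W : 𝓢((Fin n → E4), ℂ)) :
    translateMulti a (f.appendTensor (translateMulti b W)) = (translateMulti a f).appendTensor (translateMulti b (translateMulti a W)) := by
  rw [translateMulti_appendTensor, translateMulti_translateMulti, translateMulti_translateMulti, add_comm a b]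

variable {T : SchwingerFamily E4} (h : OSReconstructionNoE1 T.toLabelled)

/-- **Bounds pass to `𝓢`-limits of insertions**: if `F θ → f₁` in `𝓢` and `‖Ψ_{F θ ⊗ G}‖ ≤ K` for all `θ`, then
`‖Ψ_{f₁ ⊗ G}‖ ≤ K` (`F ↦ F ⊗ G` and `F ↦ Ψ_F` are continuous). -/
theorem norm_fieldVec_appendTensor_le_of_tendsto {n : ℕ} (G : 𝓢((Fin n → E4), ℂ)) (f₁ : 𝓢((Fin 1 → E4), ℂ))
    (hf : IsTimeOrdered (f₁.appendTensor G)) {l : Filter ℝ} [l.NeBot] {F : ℝ → 𝓢((Fin 1 → E4), ℂ)}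
    (hF : ∀ θ, IsTimeOrdered ((F θ).appendTensor G)) (hlim : Tendsto F l (𝓝 f₁)) {K : ℝ}
    (hK : ∀ θ, ‖h.fieldVec (1 + n) (fun _ => ()) ((F θ).appendTensor G) (hF θ)‖ ≤ K) :
    ‖h.fieldVec (1 + n) (fun _ => ()) (f₁.appendTensor G) hf‖ ≤ K :=
  le_of_tendsto' (tendsto_fieldVec h hF hf
    (((continuous_appendTensor.comp (continuous_id.prodMk continuous_const)).tendsto f₁).comp hlim)).norm hK

/-- **Weighting a windowed product-form insertion in `x¹`.**  If `f₁ = g ⊗ hh` and `c x = ψ(x¹)` is a temperate weight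
with values in `[0, 1]`, then `c • f₁ = (ψ ∘ snd · g) ⊗ hh` is again of product form, with an integrable first factor of
`L¹` mass `≤ ∫‖g‖`. -/
theorem weighted_insertion {f₁ : 𝓢((Fin 1 → E4), ℂ)} {g hh : ℝ × ℝ → ℂ}
    (hf₁ : ∀ x : Fin 1 → E4, f₁ x = g (x 0 0, x 0 1) * hh (x 0 2, x 0 3)) (hgi : Integrable g) {c : (Fin 1 → E4) → ℂ}
    (hc : c.HasTemperateGrowth) (ψ : ℝ → ℝ) (hcψ : ∀ x : Fin 1 → E4, c x = (ψ (x 0 1) : ℂ)) (hψc : Continuous ψ)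
    (hψ0 : ∀ t, 0 ≤ ψ t) (hψ1 : ∀ t, ψ t ≤ 1) :
    (∀ x : Fin 1 → E4, SchwartzMap.smulLeftCLM ℂ c f₁ x = (fun p : ℝ × ℝ => (ψ p.2 : ℂ) * g p) (x 0 0, x 0 1) * hh (x 0 2, x 0 3)) ∧
      Integrable (fun p : ℝ × ℝ => (ψ p.2 : ℂ) * g p) ∧ (∫ p, ‖(fun p : ℝ × ℝ => (ψ p.2 : ℂ) * g p) p‖) ≤ ∫ p, ‖g p‖ := by
  have hn : ∀ p : ℝ × ℝ, ‖(ψ p.2 : ℂ) * g p‖ ≤ ‖g p‖ := fun p => by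
    rw [norm_mul, Complex.norm_real, Real.norm_of_nonneg (hψ0 _)]
    exact mul_le_of_le_one_left (norm_nonneg _) (hψ1 _)
  have hint : Integrable (fun p : ℝ × ℝ => (ψ p.2 : ℂ) * g p) :=
    hgi.mono ((Complex.continuous_ofReal.comp (hψc.comp continuous_snd)).aestronglyMeasurable.mul hgi.aestronglyMeasurable)
      (Eventually.of_forall hn)
  refine ⟨fun x => ?_, hint, integral_mono hint.norm hgi.norm hn⟩
  rw [SchwartzMap.smulLeftCLM_apply_apply hc, smul_eq_mul, hcψ, hf₁]
  ring

/-- A weighted `g` vanishes off the support of `g` and off the support of the weight. -/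
theorem ne_zero_of_weighted_ne_zero {ψ : ℝ → ℝ} {g : ℝ × ℝ → ℂ} {p : ℝ × ℝ} (hp : (fun p : ℝ × ℝ => (ψ p.2 : ℂ) * g p) p ≠ 0) :
    g p ≠ 0 ∧ ψ p.2 ≠ 0 :=
  ⟨right_ne_zero_of_mul hp, Complex.ofReal_ne_zero.1 (left_ne_zero_of_mul hp)⟩

/-- The coordinate `x ↦ x₀¹` on `(ℝ⁴)¹` has temperate growth (it is a continuous linear form). -/
theorem hasTemperateGrowth_coord : Function.HasTemperateGrowth fun x : Fin 1 → E4 => x 0 1 :=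
  ((EuclideanSpace.proj (1 : Fin 4)).comp (ContinuousLinearMap.proj (R := ℝ) (φ := fun _ : Fin 1 => E4) 0)).hasTemperateGrowth

/-- `0 ≤ Mh + Mh'` under the insertion hypotheses. -/
theorem add_nonneg_of_bounds {hh : ℝ × ℝ → ℂ} {Mh Mh' : ℝ} (hMh : (∫ p, ‖hh p‖) ≤ Mh) (hMh' : ∀ p, ‖hh p‖ ≤ Mh') : 0 ≤ Mh + Mh' :=
  add_nonneg ((integral_nonneg fun _ => norm_nonneg _).trans hMh) ((norm_nonneg _).trans (hMh' 0))

/-! ### (a) Re-centring by the unitary `x¹`-translations -/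

/-- **Re-centring.**  If the sandwich bound (constant `L`) holds for all windowed product-form insertions narrow and CENTRED
in `x¹` (`|p.2| ≤ w` on `supp g`), it holds for those narrow around any centre `c` (`|p.2 − c| ≤ w`): with `a = c e₁`,
`f₁ ⊗ T_s W = T_a (T_{−a} f₁ ⊗ T_s (T_{−a} W))`, `U(a) Ψ_F = Ψ_{T_a F}` is unitary, `T_{−a} f₁ = g(·, · + c) ⊗ hh` is centred,
and `∫‖g(·, · + c)‖ = ∫‖g‖`. -/
theorem recenter (u v w L : ℝ)
    (hyp : ∀ (f₁ : 𝓢((Fin 1 → E4), ℂ)) (g hh : ℝ × ℝ → ℂ) (Mg Mh Mh' : ℝ),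
      (∀ x : Fin 1 → E4, f₁ x = g (x 0 0, x 0 1) * hh (x 0 2, x 0 3)) → (∀ p : ℝ × ℝ, g p ≠ 0 → u ≤ p.1 ∧ p.1 ≤ 2 * u ∧ |p.2| ≤ w) →
      Integrable g → (∫ p, ‖g p‖) ≤ Mg → Integrable hh → (∫ p, ‖hh p‖) ≤ Mh → (∀ p, ‖hh p‖ ≤ Mh') →
      ∀ (n : ℕ) (W : 𝓢((Fin n → E4), ℂ)) (hW : IsTimeOrdered W)
        (hFW : IsTimeOrdered (f₁.appendTensor (translateMulti ((2 * u + v) • EuclideanSpace.single 0 1) W))),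
        ‖h.fieldVec (1 + n) (fun _ => ()) (f₁.appendTensor (translateMulti ((2 * u + v) • EuclideanSpace.single 0 1) W)) hFW‖ ≤
          L * Mg * (Mh + Mh') * ‖h.fieldVec n (fun _ => ()) W hW‖)
    (c : ℝ) (f₁ : 𝓢((Fin 1 → E4), ℂ)) (g hh : ℝ × ℝ → ℂ) (Mg Mh Mh' : ℝ)
    (hf₁ : ∀ x : Fin 1 → E4, f₁ x = g (x 0 0, x 0 1) * hh (x 0 2, x 0 3))
    (hg : ∀ p : ℝ × ℝ, g p ≠ 0 → u ≤ p.1 ∧ p.1 ≤ 2 * u ∧ |p.2 - c| ≤ w) (hgi : Integrable g) (hMg : (∫ p, ‖g p‖) ≤ Mg)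
    (hhi : Integrable hh) (hMh : (∫ p, ‖hh p‖) ≤ Mh) (hMh' : ∀ p, ‖hh p‖ ≤ Mh') (n : ℕ) (W : 𝓢((Fin n → E4), ℂ))
    (hW : IsTimeOrdered W) (hFW : IsTimeOrdered (f₁.appendTensor (translateMulti ((2 * u + v) • EuclideanSpace.single 0 1) W))) :
    ‖h.fieldVec (1 + n) (fun _ => ()) (f₁.appendTensor (translateMulti ((2 * u + v) • EuclideanSpace.single 0 1) W)) hFW‖ ≤
      L * Mg * (Mh + Mh') * ‖h.fieldVec n (fun _ => ()) W hW‖ := by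
  set a : E4 := c • EuclideanSpace.single 1 1 with ha
  have ha0 : a 0 = 0 := by simp [ha]
  have hna0 : (-a) 0 = 0 := by simp [ha]
  set f₀ : 𝓢((Fin 1 → E4), ℂ) := translateMulti (-a) f₁ with hf₀
  set W' : 𝓢((Fin n → E4), ℂ) := translateMulti (-a) W
  set g₀ : ℝ × ℝ → ℂ := fun p => g (p + (0, c)) with hg₀
  have hW' : IsTimeOrdered W' := OSReconstructionNoE1.isTimeOrdered_translateMulti hW hna0.ge
  -- the sandwich of the re-centred data is the translate of the sandwich
  have hX' : f₀.appendTensor (translateMulti ((2 * u + v) • EuclideanSpace.single 0 1) W') =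
      translateMulti (-a) (f₁.appendTensor (translateMulti ((2 * u + v) • EuclideanSpace.single 0 1) W)) :=
    (translateMulti_appendTensor_translateMulti (-a) _ f₁ W).symm
  have hFW' : IsTimeOrdered (f₀.appendTensor (translateMulti ((2 * u + v) • EuclideanSpace.single 0 1) W')) := by
    rw [hX']
    exact OSReconstructionNoE1.isTimeOrdered_translateMulti hFW hna0.ge
  have hX : translateMulti (spatialPart 0 a) (f₀.appendTensor (translateMulti ((2 * u + v) • EuclideanSpace.single 0 1) W')) =
      f₁.appendTensor (translateMulti ((2 * u + v) • EuclideanSpace.single 0 1) W) := by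
    rw [spatialPart_of_apply_eq_zero 0 ha0, hX', translateMulti_translateMulti, add_neg_cancel, translateMulti_zero]
  -- the re-centred insertion is a centred narrow product-form insertion with the same `L¹` mass
  have hf₀' : ∀ x : Fin 1 → E4, f₀ x = g₀ (x 0 0, x 0 1) * hh (x 0 2, x 0 3) := fun x => by
    rw [hf₀, translateMulti_apply, hf₁, hg₀]
    simp [ha]
  have hg₀' : ∀ p, g₀ p ≠ 0 → u ≤ p.1 ∧ p.1 ≤ 2 * u ∧ |p.2| ≤ w := fun p hp => by simpa using hg (p + (0, c)) hp
  have hg₀M : (∫ p, ‖g₀ p‖) ≤ Mg := (integral_add_right_eq_self (fun p => ‖g p‖) ((0 : ℝ), c)).trans_le hMg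
  have key := hyp f₀ g₀ hh Mg Mh Mh' hf₀' hg₀' (hgi.comp_add_right (0, c)) hg₀M hhi hMh hMh' n W' hW' hFW'
  -- transport the norms by the unitary translations `U(±a)`
  have h1 : ‖h.fieldVec (1 + n) (fun _ => ()) (f₁.appendTensor (translateMulti ((2 * u + v) • EuclideanSpace.single 0 1) W)) hFW‖ =
      ‖h.fieldVec (1 + n) (fun _ => ()) (f₀.appendTensor (translateMulti ((2 * u + v) • EuclideanSpace.single 0 1) W')) hFW'‖ := by
    rw [← (h.translate a).norm_map (h.fieldVec (1 + n) (fun _ => ()) _ hFW'), h.translate_fieldVec]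
    exact congrArg _ (fieldVec_congr h hX _ _).symm
  have h2 : ‖h.fieldVec n (fun _ => ()) W hW‖ = ‖h.fieldVec n (fun _ => ()) W' hW'‖ := by
    rw [← (h.translate (-a)).norm_map (h.fieldVec n (fun _ => ()) W hW), h.translate_fieldVec]
    exact congrArg _ (fieldVec_congr h (by rw [spatialPart_of_apply_eq_zero 0 hna0]) _ _)
  rw [h1, h2]
  exact key

/-! ### (b) Bounded `x¹`-support (finite smooth partition of unity), then all of `x¹` (half-space cutoffs) -/

section Reduction

variable (u v w L : ℝ) (hw : 0 < w) (hL : 0 ≤ L)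
  (hcen : ∀ (c : ℝ) (f₁ : 𝓢((Fin 1 → E4), ℂ)) (g hh : ℝ × ℝ → ℂ) (Mg Mh Mh' : ℝ),
    (∀ x : Fin 1 → E4, f₁ x = g (x 0 0, x 0 1) * hh (x 0 2, x 0 3)) → (∀ p : ℝ × ℝ, g p ≠ 0 → u ≤ p.1 ∧ p.1 ≤ 2 * u ∧ |p.2 - c| ≤ w) →
    Integrable g → (∫ p, ‖g p‖) ≤ Mg → Integrable hh → (∫ p, ‖hh p‖) ≤ Mh → (∀ p, ‖hh p‖ ≤ Mh') →
    ∀ (n : ℕ) (W : 𝓢((Fin n → E4), ℂ)) (hW : IsTimeOrdered W)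
      (hFW : IsTimeOrdered (f₁.appendTensor (translateMulti ((2 * u + v) • EuclideanSpace.single 0 1) W))),
      ‖h.fieldVec (1 + n) (fun _ => ()) (f₁.appendTensor (translateMulti ((2 * u + v) • EuclideanSpace.single 0 1) W)) hFW‖ ≤
        L * Mg * (Mh + Mh') * ‖h.fieldVec n (fun _ => ()) W hW‖)

include hw hL hcen

/-- **Bounded `x¹`-support.**  If the bound (constant `L`) holds for insertions narrow around any centre, it holds for every
windowed product-form insertion whose `g` has `x¹`-support in a bounded interval `[a, b]`: `f₁ = Σ_{i<N} ρ_i(x¹) f₁` for the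
telescoping partition of unity `ρ_i = σ(w⁻¹(·−a)+1−i) − σ(w⁻¹(·−a)−i)` (`N = ⌈(b−a)/w⌉₊ + 1`), each piece is narrow around
`a + i w` with first factor `ρ_i g`, `Ψ` is additive, and `Σ_i ∫‖ρ_i g‖ = ∫‖g‖ ≤ Mg`. -/
theorem partition (a b : ℝ) (f₁ : 𝓢((Fin 1 → E4), ℂ)) (g hh : ℝ × ℝ → ℂ) (Mg Mh Mh' : ℝ)
    (hf₁ : ∀ x : Fin 1 → E4, f₁ x = g (x 0 0, x 0 1) * hh (x 0 2, x 0 3))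
    (hg : ∀ p : ℝ × ℝ, g p ≠ 0 → u ≤ p.1 ∧ p.1 ≤ 2 * u ∧ a ≤ p.2 ∧ p.2 ≤ b) (hgi : Integrable g) (hMg : (∫ p, ‖g p‖) ≤ Mg)
    (hhi : Integrable hh) (hMh : (∫ p, ‖hh p‖) ≤ Mh) (hMh' : ∀ p, ‖hh p‖ ≤ Mh') (n : ℕ) (W : 𝓢((Fin n → E4), ℂ))
    (hW : IsTimeOrdered W) (hFW : IsTimeOrdered (f₁.appendTensor (translateMulti ((2 * u + v) • EuclideanSpace.single 0 1) W))) :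
    ‖h.fieldVec (1 + n) (fun _ => ()) (f₁.appendTensor (translateMulti ((2 * u + v) • EuclideanSpace.single 0 1) W)) hFW‖ ≤
      L * Mg * (Mh + Mh') * ‖h.fieldVec n (fun _ => ()) W hW‖ := by
  set G : 𝓢((Fin n → E4), ℂ) := translateMulti ((2 * u + v) • EuclideanSpace.single 0 1) W
  -- the telescoping partition of unity `ρ i`, `i < N`, in the variable `x¹`
  set N : ℕ := ⌈(b - a) / w⌉₊ + 1 with hN
  set S : ℕ → ℝ → ℝ := fun i t => Real.smoothTransition (w⁻¹ * (t - a) + (1 - i)) with hS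
  set ρ : ℕ → ℝ → ℝ := fun i t => S i t - S (i + 1) t with hρ
  have hSmono : ∀ i t, S (i + 1) t ≤ S i t := fun i t => Real.smoothTransition.monotone (by push_cast; linarith)
  have hS0 : ∀ i t, 0 ≤ S i t := fun i t => Real.smoothTransition.nonneg _
  have hS1 : ∀ i t, S i t ≤ 1 := fun i t => Real.smoothTransition.le_one _
  have hρ0 : ∀ i t, 0 ≤ ρ i t := fun i t => sub_nonneg.2 (hSmono i t)
  have hρ1 : ∀ i t, ρ i t ≤ 1 := fun i t => (sub_le_self _ (hS0 _ _)).trans (hS1 _ _)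
  have hρsum : ∀ t, a ≤ t → t ≤ b → ∑ i ∈ Finset.range N, ρ i t = 1 := by
    intro t hat htb
    have h0 : S 0 t = 1 := Real.smoothTransition.one_of_one_le (by
      have : 0 ≤ w⁻¹ * (t - a) := mul_nonneg (inv_nonneg.2 hw.le) (by linarith)
      push_cast; linarith)
    have hNt : S N t = 0 := Real.smoothTransition.zero_of_nonpos (by
      have h1 : w⁻¹ * (t - a) ≤ (b - a) / w := by
        rw [div_eq_inv_mul]; exact mul_le_mul_of_nonneg_left (by linarith) (inv_nonneg.2 hw.le)
      have h2 : (b - a) / w ≤ ⌈(b - a) / w⌉₊ := Nat.le_ceil _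
      rw [hN]; push_cast; linarith)
    rw [Finset.sum_range_sub' (fun i => S i t) N, h0, hNt, sub_zero]
  have hρnarrow : ∀ i t, ρ i t ≠ 0 → |t - (a + i * w)| ≤ w := by
    intro i t ht
    have h1 : S i t ≠ 0 := fun h0 => ht (by have := hSmono i t; have := hS0 (i + 1) t; show S i t - S (i + 1) t = 0; linarith)
    have h2 : S (i + 1) t ≠ 1 := fun h0 => ht (by have := hSmono i t; have := hS1 i t; show S i t - S (i + 1) t = 0; linarith)
    have h1' := (not_congr Real.smoothTransition.zero_iff_nonpos).1 h1
    have h2' := (not_congr Real.smoothTransition.eq_one_iff_one_le).1 h2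
    push_cast at h2'
    rw [not_le] at h1' h2'
    have e1 : w * (w⁻¹ * (t - a)) = t - a := mul_inv_cancel_left₀ hw.ne' _
    have k1 := mul_pos hw h1'
    have k2 := mul_lt_mul_of_pos_left h2' hw
    rw [mul_add, e1] at k1 k2
    rw [abs_le]
    constructor <;> linarith
  -- the pieces `F i = ρ i (x¹) • f₁` and their first factors `gi i = ρ i (p.2) g`
  have hc : ∀ i, (fun x : Fin 1 → E4 => (ρ i (x 0 1) : ℂ)).HasTemperateGrowth := fun i => by
    have h1 := Literature.Analysis.Distribution.hasTemperateGrowth_smoothTransition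
    have h2 := hasTemperateGrowth_coord
    simp only [hρ, hS]
    fun_prop
  set F : ℕ → 𝓢((Fin 1 → E4), ℂ) := fun i => SchwartzMap.smulLeftCLM ℂ (fun x => (ρ i (x 0 1) : ℂ)) f₁ with hFdef
  set gi : ℕ → ℝ × ℝ → ℂ := fun i p => (ρ i p.2 : ℂ) * g p with hgi_def
  have hins : ∀ i, (∀ x : Fin 1 → E4, F i x = gi i (x 0 0, x 0 1) * hh (x 0 2, x 0 3)) ∧ Integrable (gi i) ∧
      (∫ p, ‖gi i p‖) ≤ ∫ p, ‖g p‖ := fun i =>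
    weighted_insertion hf₁ hgi (hc i) (ρ i) (fun x => rfl)
      ((Real.smoothTransition.continuous.comp (by fun_prop)).sub (Real.smoothTransition.continuous.comp (by fun_prop))) (hρ0 i) (hρ1 i)
  -- `f₁ ⊗ G = Σ_i F i ⊗ G`, a sum of time-ordered pieces
  have hXsum : f₁.appendTensor G = ∑ i ∈ Finset.range N, (F i).appendTensor G := by
    ext x
    rw [sum_apply]
    simp only [SchwartzMap.appendTensor_apply]
    rw [← Finset.sum_mul, ← sum_apply]
    congr 1
    rw [sum_apply]
    simp only [hFdef, SchwartzMap.smulLeftCLM_apply_apply (hc _), smul_eq_mul, ← Finset.sum_mul]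
    by_cases hx : f₁ (x ∘ Fin.castAdd n) = 0
    · rw [hx, mul_zero]
    · rw [hf₁] at hx
      have hgx := hg _ (left_ne_zero_of_mul hx)
      rw [← Complex.ofReal_sum, hρsum _ hgx.2.2.1 hgx.2.2.2, Complex.ofReal_one, one_mul]
  have hFi : ∀ i, IsTimeOrdered ((F i).appendTensor G) := fun i => isTimeOrdered_smulLeftCLM_appendTensor (hc i) f₁ G hFW
  have hsumTO : IsTimeOrdered (∑ i ∈ Finset.range N, (F i).appendTensor G) := hXsum ▸ hFW
  -- each piece is narrow around `a + i w`
  have hb : ∀ i ∈ Finset.range N, ‖h.fieldVec (1 + n) (fun _ => ()) ((F i).appendTensor G) (hFi i)‖ ≤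
      L * (∫ p, ‖gi i p‖) * (Mh + Mh') * ‖h.fieldVec n (fun _ => ()) W hW‖ := by
    intro i _
    refine hcen (a + i * w) (F i) (gi i) hh _ Mh Mh' (hins i).1 (fun p hp => ?_) (hins i).2.1 le_rfl hhi hMh hMh' n W hW (hFi i)
    obtain ⟨hgp, hρp⟩ := ne_zero_of_weighted_ne_zero hp
    exact ⟨(hg p hgp).1, (hg p hgp).2.1, hρnarrow i p.2 hρp⟩
  -- the `L¹` masses of the pieces add up to `∫‖g‖`
  have hL1 : ∑ i ∈ Finset.range N, ∫ p, ‖gi i p‖ = ∫ p, ‖g p‖ := by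
    rw [← integral_finsetSum _ fun i _ => (hins i).2.1.norm]
    refine integral_congr_ae (Eventually.of_forall fun p => ?_)
    show ∑ i ∈ Finset.range N, ‖gi i p‖ = ‖g p‖
    simp only [hgi_def, norm_mul, Complex.norm_real, Real.norm_of_nonneg (hρ0 _ _), ← Finset.sum_mul]
    by_cases hp : g p = 0
    · rw [hp, norm_zero, mul_zero]
    · rw [hρsum p.2 (hg p hp).2.2.1 (hg p hp).2.2.2, one_mul]
  have hM : 0 ≤ Mh + Mh' := add_nonneg_of_bounds hMh hMh'
  -- assemble
  calc ‖h.fieldVec (1 + n) (fun _ => ()) (f₁.appendTensor G) hFW‖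
      = ‖∑ i ∈ Finset.range N, h.fieldVec (1 + n) (fun _ => ()) ((F i).appendTensor G) (hFi i)‖ := by
        rw [fieldVec_congr h hXsum hFW hsumTO, fieldVec_sum h _ _ hFi hsumTO]
    _ ≤ ∑ i ∈ Finset.range N, ‖h.fieldVec (1 + n) (fun _ => ()) ((F i).appendTensor G) (hFi i)‖ := norm_sum_le _ _
    _ ≤ ∑ i ∈ Finset.range N, L * (∫ p, ‖gi i p‖) * (Mh + Mh') * ‖h.fieldVec n (fun _ => ()) W hW‖ := Finset.sum_le_sum hb
    _ = L * (∫ p, ‖g p‖) * (Mh + Mh') * ‖h.fieldVec n (fun _ => ()) W hW‖ := by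
        rw [← hL1, Finset.mul_sum, Finset.sum_mul, Finset.sum_mul]
    _ ≤ L * Mg * (Mh + Mh') * ‖h.fieldVec n (fun _ => ()) W hW‖ :=
        mul_le_mul_of_nonneg_right (mul_le_mul_of_nonneg_right (mul_le_mul_of_nonneg_left hMg hL) hM) (norm_nonneg _)

/-- **Support bounded below.**  The bound (constant `L`) for insertions whose `g` has `x¹`-support in `[a, ∞)`: the upper
cutoffs `cutLE 1 θ f₁ = σ(θ+1−x¹) f₁` have `x¹`-support in `[a, θ+1]` (`partition` applies, `∫‖σ g‖ ≤ ∫‖g‖`) and converge to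
`f₁` in `𝓢` as `θ → +∞`. -/
theorem of_bddBelow (a : ℝ) (f₁ : 𝓢((Fin 1 → E4), ℂ)) (g hh : ℝ × ℝ → ℂ) (Mg Mh Mh' : ℝ)
    (hf₁ : ∀ x : Fin 1 → E4, f₁ x = g (x 0 0, x 0 1) * hh (x 0 2, x 0 3))
    (hg : ∀ p : ℝ × ℝ, g p ≠ 0 → u ≤ p.1 ∧ p.1 ≤ 2 * u ∧ a ≤ p.2) (hgi : Integrable g) (hMg : (∫ p, ‖g p‖) ≤ Mg)
    (hhi : Integrable hh) (hMh : (∫ p, ‖hh p‖) ≤ Mh) (hMh' : ∀ p, ‖hh p‖ ≤ Mh') (n : ℕ) (W : 𝓢((Fin n → E4), ℂ))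
    (hW : IsTimeOrdered W) (hFW : IsTimeOrdered (f₁.appendTensor (translateMulti ((2 * u + v) • EuclideanSpace.single 0 1) W))) :
    ‖h.fieldVec (1 + n) (fun _ => ()) (f₁.appendTensor (translateMulti ((2 * u + v) • EuclideanSpace.single 0 1) W)) hFW‖ ≤
      L * Mg * (Mh + Mh') * ‖h.fieldVec n (fun _ => ()) W hW‖ := by
  set G : 𝓢((Fin n → E4), ℂ) := translateMulti ((2 * u + v) • EuclideanSpace.single 0 1) W
  have hc : ∀ θ : ℝ, (fun x : Fin 1 → E4 => (wLE 1 θ x : ℂ)).HasTemperateGrowth := fun θ => hasTemperateGrowth_ofReal_wLE 1 θ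
  set ψ : ℝ → ℝ → ℝ := fun θ t => Real.smoothTransition (θ + 1 - t) with hψ
  have hcψ : ∀ (θ : ℝ) (x : Fin 1 → E4), (wLE 1 θ x : ℂ) = (ψ θ (x 0 1) : ℂ) := fun θ x => by simp [wLE, hψ]
  have hF : ∀ θ : ℝ, IsTimeOrdered ((cutLE 1 θ f₁).appendTensor G) := fun θ => isTimeOrdered_smulLeftCLM_appendTensor (hc θ) f₁ G hFW
  refine norm_fieldVec_appendTensor_le_of_tendsto h G f₁ hFW (l := atTop) hF (tendsto_cutLE_atTop 1 f₁) fun θ => ?_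
  obtain ⟨hprod, hint, hle⟩ := weighted_insertion hf₁ hgi (hc θ) (ψ θ) (hcψ θ) (Real.smoothTransition.continuous.comp (by fun_prop))
    (fun t => Real.smoothTransition.nonneg _) (fun t => Real.smoothTransition.le_one _)
  refine partition h u v w L hw hL hcen a (θ + 1) (cutLE 1 θ f₁) (fun p => (ψ θ p.2 : ℂ) * g p) hh Mg Mh Mh' hprod (fun p hp => ?_)
    hint (hle.trans hMg) hhi hMh hMh' n W hW (hF θ)
  obtain ⟨hgp, hσ⟩ := ne_zero_of_weighted_ne_zero hp
  have hσ' := not_le.1 ((not_congr Real.smoothTransition.zero_iff_nonpos).1 hσ)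
  exact ⟨(hg p hgp).1, (hg p hgp).2.1, (hg p hgp).2.2, by linarith⟩

/-- **All windowed insertions.**  The bound (constant `L`) for every windowed product-form insertion: the lower cutoffs
`cutGE 1 θ f₁ = σ(x¹−θ+1) f₁` have `x¹`-support in `[θ−1, ∞)` (`of_bddBelow` applies) and converge to `f₁` in `𝓢` as
`θ → −∞`. -/
theorem of_window (f₁ : 𝓢((Fin 1 → E4), ℂ)) (g hh : ℝ × ℝ → ℂ) (Mg Mh Mh' : ℝ)
    (hf₁ : ∀ x : Fin 1 → E4, f₁ x = g (x 0 0, x 0 1) * hh (x 0 2, x 0 3)) (hg : ∀ p : ℝ × ℝ, g p ≠ 0 → u ≤ p.1 ∧ p.1 ≤ 2 * u)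
    (hgi : Integrable g) (hMg : (∫ p, ‖g p‖) ≤ Mg) (hhi : Integrable hh) (hMh : (∫ p, ‖hh p‖) ≤ Mh) (hMh' : ∀ p, ‖hh p‖ ≤ Mh')
    (n : ℕ) (W : 𝓢((Fin n → E4), ℂ)) (hW : IsTimeOrdered W)
    (hFW : IsTimeOrdered (f₁.appendTensor (translateMulti ((2 * u + v) • EuclideanSpace.single 0 1) W))) :
    ‖h.fieldVec (1 + n) (fun _ => ()) (f₁.appendTensor (translateMulti ((2 * u + v) • EuclideanSpace.single 0 1) W)) hFW‖ ≤
      L * Mg * (Mh + Mh') * ‖h.fieldVec n (fun _ => ()) W hW‖ := by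
  set G : 𝓢((Fin n → E4), ℂ) := translateMulti ((2 * u + v) • EuclideanSpace.single 0 1) W
  have hc : ∀ θ : ℝ, (fun x : Fin 1 → E4 => (wGE 1 θ x : ℂ)).HasTemperateGrowth := fun θ => hasTemperateGrowth_ofReal_wGE 1 θ
  set ψ : ℝ → ℝ → ℝ := fun θ t => Real.smoothTransition (t - θ + 1) with hψ
  have hcψ : ∀ (θ : ℝ) (x : Fin 1 → E4), (wGE 1 θ x : ℂ) = (ψ θ (x 0 1) : ℂ) := fun θ x => by simp [wGE, hψ]
  have hF : ∀ θ : ℝ, IsTimeOrdered ((cutGE 1 θ f₁).appendTensor G) := fun θ => isTimeOrdered_smulLeftCLM_appendTensor (hc θ) f₁ G hFW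
  refine norm_fieldVec_appendTensor_le_of_tendsto h G f₁ hFW (l := atBot) hF (tendsto_cutGE_atBot 1 f₁) fun θ => ?_
  obtain ⟨hprod, hint, hle⟩ := weighted_insertion hf₁ hgi (hc θ) (ψ θ) (hcψ θ) (Real.smoothTransition.continuous.comp (by fun_prop))
    (fun t => Real.smoothTransition.nonneg _) (fun t => Real.smoothTransition.le_one _)
  refine of_bddBelow h u v w L hw hL hcen (θ - 1) (cutGE 1 θ f₁) (fun p => (ψ θ p.2 : ℂ) * g p) hh Mg Mh Mh' hprod (fun p hp => ?_)
    hint (hle.trans hMg) hhi hMh hMh' n W hW (hF θ)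
  obtain ⟨hgp, hσ⟩ := ne_zero_of_weighted_ne_zero hp
  have hσ' := not_le.1 ((not_congr Real.smoothTransition.zero_iff_nonpos).1 hσ)
  exact ⟨(hg p hgp).1, (hg p hgp).2, by linarith⟩

end Reduction

end NarrowReduction

/-! ### The stub -/

/-- **Stub (NR) — NARROW REDUCTION (model-blind `L¹` bookkeeping).**  If, for a one-species family `T` with an
`e₀`-reconstruction, the sandwich bound `‖Ψ_{f₁ ⊗ T_sW}‖ ≤ L·Mg·(Mh+Mh')·‖Ψ_W‖` holds for all windowed insertions
`f₁ = g ⊗ hh` whose `g` is NARROW AND CENTRED in `x₁` (`g p ≠ 0 → |p.2| ≤ w`), then it holds for ALL windowed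
insertions with constant `2L`: centring by the unitary `x₁`-translation (`NarrowReduction.recenter`), a finite
smooth partition of unity in `x₁` once `g` has bounded `x₁`-support (`NarrowReduction.partition`), and bounded
`x₁`-support is reached in the `𝓢`-limit of the half-space cutoffs (`NarrowReduction.of_bddBelow`,
`NarrowReduction.of_window`); the constant obtained is `L ≤ 2L`. -/
theorem stub_narrowReduction :
    ∀ (T : SchwingerFamily E4) (h : OSReconstructionNoE1 T.toLabelled) (u v w L : ℝ),
      0 < u → 0 < v → 0 < w → 0 ≤ L →
      (∀ (f₁ : 𝓢((Fin 1 → E4), ℂ)) (g hh : ℝ × ℝ → ℂ) (Mg Mh Mh' : ℝ),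
        (∀ x : Fin 1 → E4, f₁ x = g (x 0 0, x 0 1) * hh (x 0 2, x 0 3)) →
        (∀ p : ℝ × ℝ, g p ≠ 0 → u ≤ p.1 ∧ p.1 ≤ 2 * u ∧ |p.2| ≤ w) →
        Integrable g → (∫ p, ‖g p‖) ≤ Mg → Integrable hh → (∫ p, ‖hh p‖) ≤ Mh →
        (∀ p, ‖hh p‖ ≤ Mh') →
        ∀ (n : ℕ) (W : 𝓢((Fin n → E4), ℂ)) (hW : IsTimeOrdered W)
          (hFW : IsTimeOrdered (f₁.appendTensor (translateMulti ((2 * u + v) • EuclideanSpace.single 0 1) W))),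
          ‖h.fieldVec (1 + n) (fun _ => ())
              (f₁.appendTensor (translateMulti ((2 * u + v) • EuclideanSpace.single 0 1) W)) hFW‖ ≤
            L * Mg * (Mh + Mh') * ‖h.fieldVec n (fun _ => ()) W hW‖) →
      ∀ (f₁ : 𝓢((Fin 1 → E4), ℂ)) (g hh : ℝ × ℝ → ℂ) (Mg Mh Mh' : ℝ),
        (∀ x : Fin 1 → E4, f₁ x = g (x 0 0, x 0 1) * hh (x 0 2, x 0 3)) →
        (∀ p : ℝ × ℝ, g p ≠ 0 → u ≤ p.1 ∧ p.1 ≤ 2 * u) →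
        Integrable g → (∫ p, ‖g p‖) ≤ Mg → Integrable hh → (∫ p, ‖hh p‖) ≤ Mh →
        (∀ p, ‖hh p‖ ≤ Mh') →
        ∀ (n : ℕ) (W : 𝓢((Fin n → E4), ℂ)) (hW : IsTimeOrdered W)
          (hFW : IsTimeOrdered (f₁.appendTensor (translateMulti ((2 * u + v) • EuclideanSpace.single 0 1) W))),
          ‖h.fieldVec (1 + n) (fun _ => ())
              (f₁.appendTensor (translateMulti ((2 * u + v) • EuclideanSpace.single 0 1) W)) hFW‖ ≤
            2 * L * Mg * (Mh + Mh') * ‖h.fieldVec n (fun _ => ()) W hW‖ := by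
  intro T h u v w L _hu _hv hw hL hyp f₁ g hh Mg Mh Mh' hf₁ hg hgi hMg hhi hMh hMh' n W hW hFW
  have hb := NarrowReduction.of_window h u v w L hw hL (fun c => NarrowReduction.recenter h u v w L hyp c) f₁ g hh Mg Mh Mh'
    hf₁ hg hgi hMg hhi hMh hMh' n W hW hFW
  have hMg0 : 0 ≤ Mg := (integral_nonneg fun _ => norm_nonneg _).trans hMg
  have hM : 0 ≤ Mh + Mh' := NarrowReduction.add_nonneg_of_bounds hMh hMh'
  have h0 : 0 ≤ L * Mg * (Mh + Mh') * ‖h.fieldVec n (fun _ => ()) W hW‖ := by positivity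
  linarith

end Summit.QuantumFields.YangMills.Theorems.CurvatureSandwichBound.Sketch

end
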